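import Summits.QuantumFields.YangMills.Theorems.BalabanLadderROTWardEquiv
import Summits.QuantumFields.YangMills.Theorems.BalabanLadderROTClassDefs
import HarnessLib

/-!
# Crux `ROT` (stmt-QuantumFields-20042), infinitesimal Ward route (lane B) — VIII: the Ward form ON A TORUS CLASS (rev 2′ of record)

Helper file (`--supports stmt-QuantumFields-20042`, lane `ym-rot-20042-p2`).  The owner's ROT rev 2′ of record
(`Theorems/BalabanLadderROTClassDefs.lean` §4 `ROTRev2'`: `… → LowerBounds → MomentBounds6 → GapInUnits → ∃ S, UnboundedClass S ∧ LatticeRotWardOn G r a S`)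
asks the rotation leg only along schemes whose torus half-sides lie in a class `S`.  The summation-by-parts theorem of `…WardEquiv.lean`
holds scheme by scheme, so the Ward form survives the retarget verbatim:

* `LatticeAngularWardOn G r a S` — `LatticeRotWardOn G r a S` with the conclusion moved to the angular insertion;
* `latticeRotWardOn_iff_latticeAngularWardOn` (under `MomentBounds`; `_of_momentBounds6` under the crux's UV binder);
* `ROTRev2'Angular` and `rotRev2'_iff_rotRev2'Angular : ROTRev2' ↔ ROTRev2'Angular`.

Imports `…WardEquiv` and `…ROTClassDefs` only (no Theses import: outside the BalabanLadder cone).  Nothing asserted; no fact; no sorry.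
-/

set_option autoImplicit false

noncomputable section

open scoped SchwartzMap BigOperators
open MeasureTheory Filter Topology
open Literature.MathematicalPhysics.QuantumFieldTheory Literature.MathematicalPhysics.QuantumLattice
open Literature.MathematicalPhysics.AQFT
open Literature.Probability.LatticeModels (box Site)
open Summit.QuantumFields.YangMills.Cruxes.OSLegsFromFemtoAndGap.DlrCollarTransfer (MomentBounds MomentBounds6 LowerBounds GapInUnits)
open Summit.QuantumFields.YangMills.Cruxes.OSLegsAtWeakCouplingC.Sketch (Separated SmallDiam)
open Summit.QuantumFields.YangMills.Theorems.OSLegsFromFemtoAndGap (latticeDist torusMoment momentBounds_of_momentBounds6)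
open Summit.QuantumFields.YangMills.Theorems.NPointIsotropy.Negative (E4)

namespace Summit.QuantumFields.YangMills.Theorems.ROT.Ward

section Binder

variable (G : Type) [Group G] [TopologicalSpace G] [IsTopologicalGroup G] [CompactSpace G]
  [MeasurableSpace G] [BorelSpace G] (r : LatticeRep G) (a : ℝ → ℝ)

/-- **`LatticeAngularWardOn G r a S`** — the Ward (angular-insertion) form of `Theorems.ROT.LatticeRotWardOn G r a S`: along every scheme in
units `a` whose torus half-sides lie in `S` (`β_k → ∞`, the soft-bundle ranges) there is a germ radius such that the angular insertion
`Σ_x (𝓛 W_k)(x) F(a_k x)` of the centred torus moment function tends to `0` for every test function of the germ class. -/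
def LatticeAngularWardOn (S : Set ℕ) : Prop :=
  ∀ (sch : SpeciesScheme (YMSpecies G)), (∀ k, sch.L k ∈ S) → (∀ k, sch.a k = a (sch.β k)) →
    Tendsto sch.β atTop atTop →
    (∀ k, 0 ≤ sch.β k ∧ sch.a k ≤ 1 / 24 ∧ 14 ≤ sch.L k ∧ (sch.a k)⁻¹ * (sch.a k)⁻¹ ≤ sch.L k) →
      ∃ r₀ : ℝ, 0 < r₀ ∧ ∀ (n : ℕ), 2 ≤ n → ∀ F : 𝓢((Fin n → E4), ℂ), IsOffDiagonal F →
        HasCompactSupport (F : (Fin n → E4) → ℂ) →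
        (∃ δ : ℝ, 0 < δ ∧ tsupport (F : (Fin n → E4) → ℂ) ⊆ Separated n δ) →
        tsupport (F : (Fin n → E4) → ℂ) ⊆ SmallDiam n r₀ →
        Tendsto (fun k => angularSum
          (torusMoment r.ρ (sch.β k) (sch.L k) r.curvature.F (wilsonTorusMean r.ρ (sch.β k) (sch.L k) r.curvature.F))
          (sch.L k) (sch.a k) F) atTop (𝓝 0)

end Binder

/-- **`ROTRev2'Angular`** — the owner's ROT rev 2′ of record (`Theorems.ROT.ROTRev2'`) with `LatticeAngularWardOn` in place of
`LatticeRotWardOn` (all guards verbatim). -/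
def ROTRev2'Angular : Prop :=
  ∀ (G : Type) [Group G] [TopologicalSpace G] [IsTopologicalGroup G] [CompactSpace G],
    IsCompactSimpleLieGroup G → letI : MeasurableSpace G := borel G; haveI : BorelSpace G := ⟨rfl⟩;
    ∀ (r : LatticeRep G) (a : ℝ → ℝ), (∀ β, 0 < a β) → Tendsto a atTop (𝓝 0) →
      LowerBounds G r a → MomentBounds6 G r a → GapInUnits G r a →
        ∃ S : Set ℕ, UnboundedClass S ∧ LatticeAngularWardOn G r a S

section Equivalence

variable {G : Type} [Group G] [TopologicalSpace G] [IsTopologicalGroup G] [CompactSpace G]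
  [MeasurableSpace G] [BorelSpace G]

/-- **ROT-on-class ⇒ Ward form on the class** (under `MomentBounds`). -/
theorem latticeAngularWardOn_of_latticeRotWardOn (r : LatticeRep G) {a : ℝ → ℝ} (hMB : MomentBounds G r a) (S : Set ℕ)
    (h : LatticeRotWardOn G r a S) : LatticeAngularWardOn G r a S := by
  intro sch hS hunits hβ hranges
  obtain ⟨r₀, hr₀, hrot⟩ := h sch hS hunits hβ hranges
  refine ⟨r₀, hr₀, fun n hn F hFoff hFc hFδ hFr => ?_⟩
  obtain ⟨δ, hδ, hFδ'⟩ := hFδ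
  obtain ⟨D, hD⟩ := Summit.QuantumFields.YangMills.Cruxes.OSLegsAtWeakCouplingC.Sketch.GermWard.exists_schwartz_rotDeriv F
  have h1 := hrot n hn F D hFoff hFc ⟨δ, hδ, hFδ'⟩ hFr hD
  have h2 := tendsto_latticeDist_rotDeriv_add_angularSum r hMB sch hunits hβ hranges F D hFc hδ hFδ' hD
  simpa using h2.sub h1

/-- **Ward form on the class ⇒ ROT-on-class** (under `MomentBounds`). -/
theorem latticeRotWardOn_of_latticeAngularWardOn (r : LatticeRep G) {a : ℝ → ℝ} (hMB : MomentBounds G r a) (S : Set ℕ)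
    (h : LatticeAngularWardOn G r a S) : LatticeRotWardOn G r a S := by
  intro sch hS hunits hβ hranges
  obtain ⟨r₀, hr₀, hang⟩ := h sch hS hunits hβ hranges
  refine ⟨r₀, hr₀, fun n hn F D hFoff hFc hFδ hFr hD => ?_⟩
  obtain ⟨δ, hδ, hFδ'⟩ := hFδ
  have h1 := hang n hn F hFoff hFc ⟨δ, hδ, hFδ'⟩ hFr
  have h2 := tendsto_latticeDist_rotDeriv_add_angularSum r hMB sch hunits hβ hranges F D hFc hδ hFδ' hD
  simpa using h2.sub h1

/-- **`LatticeRotWardOn S ⟺ LatticeAngularWardOn S`** under `MomentBounds`. -/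
theorem latticeRotWardOn_iff_latticeAngularWardOn (r : LatticeRep G) {a : ℝ → ℝ} (hMB : MomentBounds G r a) (S : Set ℕ) :
    LatticeRotWardOn G r a S ↔ LatticeAngularWardOn G r a S :=
  ⟨latticeAngularWardOn_of_latticeRotWardOn r hMB S, latticeRotWardOn_of_latticeAngularWardOn r hMB S⟩

/-- **`LatticeRotWardOn S ⟺ LatticeAngularWardOn S`** under the crux's UV binder `MomentBounds6`. -/
theorem latticeRotWardOn_iff_latticeAngularWardOn_of_momentBounds6 (r : LatticeRep G) (a : ℝ → ℝ) (h6 : MomentBounds6 G r a)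
    (S : Set ℕ) : LatticeRotWardOn G r a S ↔ LatticeAngularWardOn G r a S :=
  latticeRotWardOn_iff_latticeAngularWardOn r (momentBounds_of_momentBounds6 r a h6) S

end Equivalence

/-- **ROT rev 2′ ⟺ its Ward form** (guards verbatim; the class is carried through). -/
theorem rotRev2'_iff_rotRev2'Angular : ROTRev2' ↔ ROTRev2'Angular := by
  constructor
  · intro h G _ _ _ _ hG
    letI : MeasurableSpace G := borel G
    haveI : BorelSpace G := ⟨rfl⟩
    intro r a ha ha0 hNT hMB hIR
    obtain ⟨S, hS, hrot⟩ := h G hG r a ha ha0 hNT hMB hIR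
    exact ⟨S, hS, (latticeRotWardOn_iff_latticeAngularWardOn_of_momentBounds6 r a hMB S).1 hrot⟩
  · intro h G _ _ _ _ hG
    letI : MeasurableSpace G := borel G
    haveI : BorelSpace G := ⟨rfl⟩
    intro r a ha ha0 hNT hMB hIR
    obtain ⟨S, hS, hang⟩ := h G hG r a ha ha0 hNT hMB hIR
    exact ⟨S, hS, (latticeRotWardOn_iff_latticeAngularWardOn_of_momentBounds6 r a hMB S).2 hang⟩

end Summit.QuantumFields.YangMills.Theorems.ROT.Ward

end
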